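import Summits.BirchSwinnertonDyer.BirchSwinnertonDyer.Theorems.ManinLocalTwoThreeKummerCoverNotGammaOne
import Summits.BirchSwinnertonDyer.Rank1Residual.ManinAdditive.UDCKummerLine
import HarnessLib

/-!
# (GENΣ, real case) the Kummer character of a REAL third-period is non-trivial on `Γ₁(N)` — `φ^*T ∉ Σ(N)` for every `3`-torsion point `T` with real `y`
(route `ManinLocalTwoThree`, crux C3 `ManinPrimeToThreeAtNine` stmt-BirchSwinnertonDyer-22968; cell bsd-f2-manin, C3 LEAD p1 gen 16;
`--supports stmt-BirchSwinnertonDyer-22968`; node GENΣ `KummerNotShimuraOfGeneric` of -an g39's K-LINE split of the residual RES₃♭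
(HOME/an/g39/UDCKummerLineK-an-g39.lean, MEMO-an §82: RES₃♭ ⟸ EXISTC ∧ GENΣ ∧ KLINE ∧ RESΣ), REAL CASE, UNCONDITIONAL)

p3 g15's (NC-b)@9 `KummerCover.exists_mem_gamma1_not_kummerPeriodTrivial` says: for a lattice-optimal `X₀(N)`-datum `D` at `9 ∣ N` and an analytic
lift `u` of a RATIONAL point of order `3` of the short model, some `γ ∈ Γ₁(N)` has a non-trivial Kummer period `c·{∞,γ∞}_f ∉ ℤ·3u + 3Λ_E`.
Its only use of rationality is through the lead's `no_rational_kernel_generator` (g14).  Here the hypothesis is weakened to what the argument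
actually needs — **`℘'_Λ(u)` is REAL** — which covers every `3`-torsion point `T = (X₀, Y₀)` of the short model with `Y₀ = c³℘'(u)/2 ∈ ℝ`, in
particular the `K`-points `T ∈ E(ℚ(√d))`, `d > 0`, of -an's GENΣ (Galois acting on `±T` through a REAL quadratic character):

* `derivWeierstrassP_re_eq_zero_of_kernel` — for a kernel generator `w ∈ Λ₁(f) ∖ 3Λ₀(f)` (`Λ₁ ≠ Λ₀`) and `c·w = k·3u + 3ν` (`ν ∈ Λ_E`):
  `3 ∤ k`, so `c·w/3 ≡ ±u (mod Λ_E)` and `re ℘'(u) = 0` (the lead's `conj_derivWeierstrassP_kernel`: `℘'(c·w/3)` is purely imaginary);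
* **`exists_mem_gamma1_not_kummerPeriodTrivial_of_real`** — `u ∉ Λ_E`, `3u ∈ Λ_E`, `im ℘'(u) = 0` ⟹ `∃ γ ∈ Γ₁(N), ¬ KummerPeriodTrivial D u γ`.
  Proof: if all `Γ₁(N)`-periods were trivial then `c·Λ₁(f) ⊆ S = ℤ·3u + 3Λ_E`; (A) `Λ₁ = Λ₀` contradicts `Λ_E/3Λ_E ≅ (ℤ/3)²`
  (p3's `not_forall_mem_span_three`); (B) `Λ₁ ≠ Λ₀`: a kernel generator (p3's `exists_mem_periodLatticeGamma1_not_three_mul`) gives `re ℘'(u) = 0`,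
  hence `℘'(u) = 0`, hence `2u ∈ Λ_E` (`two_mul_mem_lattice_of_derivWeierstrassP_eq_zero`), and with `3u ∈ Λ_E` also `u ∈ Λ_E` — contradiction.
  NO curve, NO torsion-point and NO rationality hypothesis is needed beyond `℘'(u) ∈ ℝ`;
* `exists_mem_gamma1_not_kummerPeriodTrivial_of_im_eq_zero` — the GENΣ-shaped wrapper: `c²℘(u) = X₀`, `c³℘'(u)/2 = Y₀` with `im Y₀ = 0` ⟹ same
  conclusion (so -an's `KummerNotShimuraOfGeneric` holds on the REAL locus `Y₀ ∈ ℝ` by name once the K-line statement file lands; the IMAGINARY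
  non-`μ₃` locus needs the printed `μ`-type structure of `Σ(N)` [Ling–Oesterlé 1991, Thm. 1] and is NOT touched here).

HONEST FRAMING.  Unconditional lattice/real-structure theorems; they do NOT prove RES₃♭, C3, Manin's conjecture or BSD (all OPEN).  No definitions,
no named facts, no sorry.
[cite: Stevens1989, §2, Thm. 2.3 (shape: the Shimura kernel)] [cite: Manin1972, §1.6 (real structure of the period lattice)]
-/

set_option autoImplicit false
-- lint-debt: the directory name repeats the summit name (sibling precedent `ManinLocalTwoThreeKummerCoverNotGammaOne.lean`)
set_option linter.dupNamespace false

noncomputable section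

open scoped Classical ComplexConjugate MatrixGroups PeriodPair
open WeierstrassCurve Literature.NumberTheory.EllipticCurves Literature.NumberTheory.EllipticCurves.ModularForms
open CongruenceSubgroup
open Summit.BirchSwinnertonDyer.Rank1Residual.ManinAdditive.UDCKummerLine

namespace Summit.BirchSwinnertonDyer.BirchSwinnertonDyer.Theorems.ManinLocalTwoThree.KummerCover

variable {W : WeierstrassCurve ℚ} {N : ℕ} [NeZero N]

/-! ### §1 A kernel relation `c·w = k·3u + 3ν` forces `re ℘'(u) = 0` -/

/-- **`re ℘'(u) = 0` from a kernel relation.**  For a lattice-optimal datum at `9 ∣ N` with `Λ₁(f) ≠ Λ₀(f)`, a kernel generator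
`w ∈ Λ₁(f) ∖ 3Λ₀(f)` and `c·w = k·3u + 3ν` with `ν ∈ Λ_E`, `3u ∈ Λ_E`: `3 ∤ k`, `c·w/3 ≡ ±u (mod Λ_E)`, and `℘'(c·w/3)` is purely imaginary
(`conj_derivWeierstrassP_kernel`), so `re ℘'(u) = 0`. [cite: Manin1972, §1.6 (real structure of the period lattice)] -/
theorem derivWeierstrassP_re_eq_zero_of_kernel [W.IsElliptic] [W.IsGloballyMinimal] (D : ModularParametrizationData W N)
    (hopt : ∀ z ∈ D.L.lattice, ∃ w ∈ periodLattice D.f, z = D.c * w) (h9 : 3 ^ 2 ∣ N)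
    (hΛ : periodLatticeGamma1 D.f ≠ periodLattice D.f)
    {w : ℂ} (hw : w ∈ periodLatticeGamma1 D.f) (hw3 : ∀ v ∈ periodLattice D.f, w ≠ 3 * v)
    {u : ℂ} (h3u : 3 * u ∈ D.L.lattice) {k : ℤ} {ν : ℂ} (hν : ν ∈ D.L.lattice)
    (hk : (D.c : ℂ) * w = k * (3 * u) + 3 * ν) :
    (℘'[D.L] u).re = 0 := by
  have hc0 : D.c ≠ 0 := D.maninConstant_ne_zero_holds
  have hc₀ : (D.c : ℂ) ≠ 0 := by exact_mod_cast hc0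
  -- `3 ∤ k`
  have hk3 : ¬ (3 : ℤ) ∣ k := by
    rintro ⟨k', rfl⟩
    have hk'u : (k' : ℂ) * (3 * u) ∈ D.L.lattice := by
      have := D.L.lattice.smul_mem (k' : ℤ) h3u; rwa [zsmul_eq_mul] at this
    have hmem : (k' : ℂ) * (3 * u) + ν ∈ D.L.lattice := add_mem hk'u hν
    obtain ⟨v, hv, hv'⟩ := hopt _ hmem
    refine hw3 v hv (mul_left_cancel₀ hc₀ ?_)
    have : (D.c : ℂ) * w = 3 * ((k' : ℂ) * (3 * u) + ν) := by rw [hk]; push_cast; ring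
    rw [this, hv']; ring
  -- `cw/3 ≡ ±u (mod Λ)`: write `k = 3q + r`, `r ∈ {1, 2}`
  have hr : k % 3 = 1 ∨ k % 3 = 2 := by omega
  have hkq : (k : ℂ) = 3 * ((k / 3 : ℤ) : ℂ) + ((k % 3 : ℤ) : ℂ) := by
    have hkq' : k = 3 * (k / 3) + k % 3 := by omega
    have := congrArg (fun t : ℤ ↦ (t : ℂ)) hkq'
    push_cast at this
    exact this
  have hq3u : ((k / 3 : ℤ) : ℂ) * (3 * u) + ν ∈ D.L.lattice := by
    have := D.L.lattice.smul_mem (k / 3 : ℤ) h3u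
    rw [zsmul_eq_mul] at this
    exact add_mem this hν
  -- `℘'(cw/3)` is purely imaginary
  have him : (℘'[D.L] ((D.c : ℂ) * w / 3)).re = 0 := by
    have h := conj_derivWeierstrassP_kernel D hopt h9 hΛ hw
    have h2 := congrArg Complex.re h
    simp only [Complex.conj_re, Complex.neg_re] at h2
    linarith
  -- `℘'(cw/3) = ±℘'(u)`
  rcases hr with h1 | h2
  · have e : (D.c : ℂ) * w / 3 = u + (((k / 3 : ℤ) : ℂ) * (3 * u) + ν) := by
      rw [hk, hkq, h1]; push_cast; ring
    rw [e, D.L.derivWeierstrassP_add_coe u ⟨_, hq3u⟩] at him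
    exact him
  · have hq3u' : ((k / 3 : ℤ) : ℂ) * (3 * u) + ν + 3 * u ∈ D.L.lattice := add_mem hq3u h3u
    have e : (D.c : ℂ) * w / 3 = -u + (((k / 3 : ℤ) : ℂ) * (3 * u) + ν + 3 * u) := by
      rw [hk, hkq, h2]; push_cast; ring
    rw [e, D.L.derivWeierstrassP_add_coe (-u) ⟨_, hq3u'⟩, PeriodPair.derivWeierstrassP_neg, Complex.neg_re, neg_eq_zero] at him
    exact him

/-! ### §2 (GENΣ, real case): a real `℘'(u)` forces a non-trivial `Γ₁(N)`-Kummer period -/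

/-- **(NC-b)@9 for REAL third-periods — GENΣ on the real locus, UNCONDITIONAL.**  For a lattice-optimal `X₀(N)`-datum `D` of a globally
minimal `W` at `9 ∣ N` and `u ∉ Λ_E` with `3u ∈ Λ_E` and `℘'_Λ(u) ∈ ℝ`, some `γ ∈ Γ₁(N)` has a NON-trivial Kummer period:
`c·{∞,γ∞}_f ∉ ℤ·3u + 3Λ_E`.  (So the pull-back of the `3`-torsion point `T ↔ u` is not in the Shimura subgroup.)  Proof in the module docstring.
[cite: Stevens1989, §2, Thm. 2.3 (shape)] -/
theorem exists_mem_gamma1_not_kummerPeriodTrivial_of_real (W : WeierstrassCurve ℚ) [W.IsElliptic] [W.IsGloballyMinimal]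
    {N : ℕ} [NeZero N] (D : ModularParametrizationData W N) (h9 : 9 ∣ N)
    (hopt : ∀ z ∈ D.L.lattice, ∃ w ∈ periodLattice D.f, z = D.c * w)
    {u : ℂ} (hu : u ∉ D.L.lattice) (h3u : 3 * u ∈ D.L.lattice) (hreal : (℘'[D.L] u).im = 0) :
    ∃ γ : Gamma0 N, (γ : SL(2, ℤ)) ∈ Gamma1 N ∧ ¬ KummerPeriodTrivial D u γ := by
  by_contra hall
  push Not at hall
  have hc0 : D.c ≠ 0 := D.maninConstant_ne_zero_holds
  have h9' : 3 ^ 2 ∣ N := by norm_num; exact h9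
  -- `S = ℤ·3u + 3Λ`, an additive subgroup containing `c·Λ₁(f)`
  let S : AddSubgroup ℂ :=
    { carrier := {x | ∃ k : ℤ, ∃ ν ∈ D.L.lattice, x = k * (3 * u) + 3 * ν}
      zero_mem' := ⟨0, 0, zero_mem _, by simp⟩
      add_mem' := by
        rintro x y ⟨k, ν, hν, rfl⟩ ⟨k', ν', hν', rfl⟩
        exact ⟨k + k', ν + ν', add_mem hν hν', by push_cast; ring⟩
      neg_mem' := by
        rintro x ⟨k, ν, hν, rfl⟩
        exact ⟨-k, -ν, neg_mem hν, by push_cast; ring⟩ }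
  have hS : ∀ w ∈ periodLatticeGamma1 D.f, (D.c : ℂ) * w ∈ S := by
    intro w hw
    refine AddSubgroup.closure_induction (p := fun x _ ↦ (D.c : ℂ) * x ∈ S) ?_ ?_ ?_ ?_ hw
    · rintro _ ⟨γ, rfl⟩
      obtain ⟨k, ν, hν, hk⟩ := hall ⟨(γ : SL(2, ℤ)), Gamma1_in_Gamma0 N γ.2⟩ γ.2
      exact ⟨k, ν, hν, hk⟩
    · simp only [mul_zero]; exact zero_mem S
    · intro x y _ _ hx hy; rw [mul_add]; exact add_mem hx hy
    · intro x _ hx; rw [mul_neg]; exact neg_mem hx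
  by_cases hΛ : periodLatticeGamma1 D.f = periodLattice D.f
  · -- (A) `Λ = cΛ₀ = cΛ₁ ⊆ S`
    refine not_forall_mem_span_three D.L h3u fun z hz ↦ ?_
    obtain ⟨w, hw, rfl⟩ := hopt z hz
    rw [← hΛ] at hw
    obtain ⟨k, ν, hν, hk⟩ := hS w hw
    exact ⟨k, ν, hν, hk⟩
  · -- (B) a kernel generator `w ∈ Λ₁ ∖ 3Λ₀` makes `℘'(u)` purely imaginary AND real, hence zero
    obtain ⟨w, hw, hw3⟩ := exists_mem_periodLatticeGamma1_not_three_mul D hopt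
    obtain ⟨k, ν, hν, hk⟩ := hS w hw
    have hre : (℘'[D.L] u).re = 0 := derivWeierstrassP_re_eq_zero_of_kernel D hopt h9' hΛ hw hw3 h3u hν hk
    have h0 : ℘'[D.L] u = 0 := Complex.ext (by rw [hre, Complex.zero_re]) (by rw [hreal, Complex.zero_im])
    -- `℘'(u) = 0 ⟹ 2u ∈ Λ`, and with `3u ∈ Λ` also `u ∈ Λ`
    have h2 := D.L.two_mul_mem_lattice_of_derivWeierstrassP_eq_zero hu h0
    apply hu
    have := D.L.lattice.sub_mem h3u h2
    rwa [show (3 : ℂ) * u - 2 * u = u by ring] at this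

/-- **GENΣ-shaped wrapper (real locus)**: for a `3`-torsion point `T = (X₀, Y₀)` of the short model `E_{W,c}` with an analytic lift `u`
(`c²℘(u) = X₀`, `c³℘'(u)/2 = Y₀`) and REAL ordinate `Y₀`, some `γ ∈ Γ₁(N)` has a non-trivial Kummer period — -an g39's `KummerNotShimuraOfGeneric`
on `{im Y₀ = 0}` (the abscissa and the non-`μ₃` clause are not even needed there). [cite: Stevens1989, §2, Thm. 2.3 (shape)] -/
theorem exists_mem_gamma1_not_kummerPeriodTrivial_of_im_eq_zero (W : WeierstrassCurve ℚ) [W.IsElliptic] [W.IsGloballyMinimal]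
    {N : ℕ} [NeZero N] (D : ModularParametrizationData W N)
    (hopt : ∀ z ∈ D.L.lattice, ∃ w ∈ periodLattice D.f, z = D.c * w) (h9 : 3 ^ 2 ∣ N)
    (Y₀ : ℂ) (hY₀ : Y₀.im = 0) {u : ℂ} (hu : u ∉ D.L.lattice) (h3u : 3 * u ∈ D.L.lattice)
    (hY : (D.c : ℂ) ^ 3 * ℘'[D.L] u / 2 = Y₀) :
    ∃ γ : Gamma0 N, (γ : SL(2, ℤ)) ∈ Gamma1 N ∧ ¬ KummerPeriodTrivial D u γ := by
  have hc0 : D.c ≠ 0 := D.maninConstant_ne_zero_holds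
  have hc₀ : (D.c : ℂ) ≠ 0 := by exact_mod_cast hc0
  have h9'' : 9 ∣ N := by norm_num at h9; exact h9
  refine exists_mem_gamma1_not_kummerPeriodTrivial_of_real W D h9'' hopt hu h3u ?_
  -- `℘'(u) = 2Y₀/c³` is real
  have he : ℘'[D.L] u = 2 * Y₀ / (D.c : ℂ) ^ 3 := by
    rw [← hY]; field_simp
  have hcre : ((D.c : ℂ) ^ 3) = (((D.c : ℝ) ^ 3 : ℝ) : ℂ) := by push_cast; ring
  rw [he, hcre, Complex.div_ofReal_im, Complex.mul_im]
  simp [hY₀]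

end Summit.BirchSwinnertonDyer.BirchSwinnertonDyer.Theorems.ManinLocalTwoThree.KummerCover

end
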